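import Mathlib
import Summits.RiemannHypothesis.RiemannHypothesis.Theorems.WeilFarCoercivityFloor
import Summits.RiemannHypothesis.RiemannHypothesis.Theorems.WeilFarFloorKappaRoot
import HarnessLib

/-!
# The floor law's main term is increasing: `pntKappa` strictly decreasing, `pntFloor` strictly increasing on `(0, ∞)`

Helper file (`--supports stmt-RiemannHypothesis-0098`, lead-track anchor: Weil-positivity window ladder, format-C far bound),
RH-free, pure proofs.  Seat rh-explicit-weil-1 gen9 (memo `run/shared/lean/pub/rh-explicit/rh-explicit-weil-1/FORMAT-K3.md` §10.14).
Both sides of the floor law C-XIII are monotone in the window: `λ_max(a)` by `farCoercivityFloor_mono` (`WeilFarCoercivityFloor`),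
and here the PNT main term `L(a) = pntFloor a = 1/(κ(a)² − ¼)`: the defining function `φ(κ, a) = 2κ·sinh(κa) − cosh(κa)` is strictly
increasing in `κ ≥ ½` (`FloorGrowth.pntPsi_strictMonoOn`) AND in `a ∈ ℝ` for `κ > ½` (`pntPsi_lt_of_lt`: `Δcosh < Δsinh < 2κ·Δsinh`), so its
root `κ(a)` strictly decreases (`pntKappa_strictAntiOn`; the root facts are `FloorGrowth.sInf_pntKappaSet_spec`) and `L(a)` strictly increases (`pntFloor_strictMonoOn`).  Standard axioms only.
-/

set_option linter.dupNamespace false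
set_option autoImplicit false

noncomputable section

open Set

namespace Summit.RiemannHypothesis.RiemannHypothesis.Theorems.WeilFormatC

namespace FloorMainTerm

/-- `φ(κ, ·)` is strictly increasing for `κ > ½`: `s < t` ⇒ `2κ·sinh(κs) − cosh(κs) < 2κ·sinh(κt) − cosh(κt)`. -/
theorem pntPsi_lt_of_lt {κ s t : ℝ} (hκ : 1 / 2 < κ) (hst : s < t) :
    2 * κ * Real.sinh (κ * s) - Real.cosh (κ * s) < 2 * κ * Real.sinh (κ * t) - Real.cosh (κ * t) := by
  have hκ0 : 0 < κ := by linarith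
  have hlt : κ * s < κ * t := mul_lt_mul_of_pos_left hst hκ0
  have hsinh : Real.sinh (κ * s) < Real.sinh (κ * t) := Real.sinh_lt_sinh.2 hlt
  -- Δcosh − Δsinh = e^{−κt} − e^{−κs} < 0
  have h1 : Real.cosh (κ * t) - Real.sinh (κ * t) = Real.exp (-(κ * t)) := Real.cosh_sub_sinh _
  have h2 : Real.cosh (κ * s) - Real.sinh (κ * s) = Real.exp (-(κ * s)) := Real.cosh_sub_sinh _
  have h3 : Real.exp (-(κ * t)) < Real.exp (-(κ * s)) := Real.exp_lt_exp.2 (by linarith)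
  nlinarith

/-- **`κ(a)` is strictly decreasing on `(0, ∞)`.** -/
theorem pntKappa_strictAntiOn : StrictAntiOn pntKappa (Ioi 0) := by
  intro a ha a' ha' haa
  rw [mem_Ioi] at ha ha'
  unfold pntKappa
  obtain ⟨hκ, heig⟩ := FloorGrowth.sInf_pntKappaSet_spec ha
  obtain ⟨hκ', heig'⟩ := FloorGrowth.sInf_pntKappaSet_spec ha'
  set κ := sInf {κ : ℝ | 1 / 2 < κ ∧ 1 / 2 ≤ κ * Real.tanh (κ * a)} with hκdef
  set κ' := sInf {κ : ℝ | 1 / 2 < κ ∧ 1 / 2 ≤ κ * Real.tanh (κ * a')} with hκ'def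
  have hφ : 2 * κ * Real.sinh (κ * a) - Real.cosh (κ * a) = 0 := by linarith
  have hφ' : 2 * κ' * Real.sinh (κ' * a') - Real.cosh (κ' * a') = 0 := by linarith
  by_contra hle
  push Not at hle
  -- φ(κ', a) < φ(κ', a') = 0 = φ(κ, a) ≤ φ(κ', a): contradiction
  have h1 : 2 * κ' * Real.sinh (κ' * a) - Real.cosh (κ' * a) < 0 := by
    have := pntPsi_lt_of_lt hκ' haa; linarith
  have h2 : 2 * κ * Real.sinh (κ * a) - Real.cosh (κ * a) ≤ 2 * κ' * Real.sinh (κ' * a) - Real.cosh (κ' * a) :=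
    (FloorGrowth.pntPsi_strictMonoOn ha).monotoneOn (show κ ∈ Ici (1 / 2 : ℝ) from hκ.le)
      (show κ' ∈ Ici (1 / 2 : ℝ) from hκ'.le) hle
  linarith

/-- **`L(a) = pntFloor a` is strictly increasing on `(0, ∞)`.** -/
theorem pntFloor_strictMonoOn : StrictMonoOn pntFloor (Ioi 0) := by
  intro a ha a' ha' haa
  have hlt := pntKappa_strictAntiOn ha ha' haa
  have hκ' : 1 / 2 < pntKappa a' := (FloorGrowth.sInf_pntKappaSet_spec (mem_Ioi.1 ha')).1
  unfold pntFloor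
  have h0 : 0 < pntKappa a' ^ 2 - 1 / 4 := by nlinarith
  refine one_div_lt_one_div_of_lt h0 ?_
  nlinarith

/-- Monotone form: `0 < a ≤ a'` ⇒ `pntFloor a ≤ pntFloor a'`. -/
theorem pntFloor_mono {a a' : ℝ} (ha : 0 < a) (haa : a ≤ a') : pntFloor a ≤ pntFloor a' :=
  pntFloor_strictMonoOn.monotoneOn (mem_Ioi.2 ha) (mem_Ioi.2 (lt_of_lt_of_le ha haa)) haa

/-- Both sides of the floor law are monotone: for `0 < a ≤ a'`, `λ_max(a) ≤ λ_max(a')` and `L(a) − 2γ_E ≤ L(a') − 2γ_E`, hence the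
discrepancy changes by at most the two increments: `|D(a') − D(a)| ≤ (λ_max(a') − λ_max(a)) + (L(a') − L(a))`. -/
theorem abs_farFloorDiscrepancy_sub_le {a a' : ℝ} (ha : 0 < a) (haa : a ≤ a') :
    |(farCoercivityFloor a' - (pntFloor a' - 2 * Real.eulerMascheroniConstant))
        - (farCoercivityFloor a - (pntFloor a - 2 * Real.eulerMascheroniConstant))|
      ≤ (farCoercivityFloor a' - farCoercivityFloor a) + (pntFloor a' - pntFloor a) := by
  have h1 := farCoercivityFloor_mono ha haa
  have h2 := pntFloor_mono ha haa
  rw [abs_le]; constructor <;> linarith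

end FloorMainTerm

end Summit.RiemannHypothesis.RiemannHypothesis.Theorems.WeilFormatC
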